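import Literature.Barriers.MatrixMultiplication.QuasirandomBarrierLieTypeC
import Literature.Barriers.MatrixMultiplication.QuasirandomBarrierLieTypeProofs
import HarnessLib

/-!
# BCGPU 2023, Cor. 3.4 for `Sp(2n, q)` / `PSp(2n, q)`: the named fact `BCGPU2023_cor34_typeC`
# REDUCED to its two printed inputs (minimal degree, class number), and the uniform-`ε` engine for
# an arbitrary Lie-type parameter set

Topic `Literature/Barriers/MatrixMultiplication`; sequel to `QuasirandomBarrierLieTypeC.lean` (the
named fact `BCGPU2023_cor34_typeC`: ONE `ε > 0` such that every TPP triple in every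
`Sp(2n, F) = Matrix.symplecticGroup (Fin n) F`, `n ≥ 1`, `F` finite, and in every central quotient
`PSp(2n, F)`, satisfies `(|S||T||U|)^{(2+ε)/3} ≤ ∑ᵢ dᵢ^{2+ε}`) and to
`QuasirandomBarrierLieTypeProofs.lean` (the same for `SL`/`PSL`, PROVED: `BCGPU2023_cor34_typeA_holds`).

Source: J. Blasiak, H. Cohn, J. A. Grochow, K. Pratt, C. Umans, *Matrix multiplication via matrix
groups*, ITCS 2023 = arXiv:2204.03826 [BlasiakCohnGrochowPrattUmans2023], Cor. 3.4 and its proof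
(held copy `paper:arxiv-2204.03826`, p. 6: bounded rank by Cor. 3.3 with `n(G) ≥ Ω(|G|^δ)`
[Landazuri–Seitz]; rank `r`, dimension `d`: `|G| = Θ(q^d)`, `n(G) ≥ Ω(q^r)` [Landazuri–Seitz],
`O(q^r)` conjugacy classes [Fulman–Guralnick], convexity; p. 7: "also for simple groups that are
quotients of groups of Lie type by their centers"; footnote 2 p. 3 lists `Sp(2n, q)`).

## What is proved here (0 `sorry`, 0 new named facts)

* §1 `exists_eps_noCertificate_family_gen A D` — the printed bounded-rank / large-rank dichotomy
  made effective for an ABSTRACT family: one `ε = ε(A, D) > 0` such that every finite non-abelian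
  `G` attached to parameters `q ≥ 2`, `r ≥ 1` with `n(G) ≥ q^r/4`, `k(G) ≤ q^{A r}` (class number)
  and `|G| ≤ q^{D r²}` satisfies Thm. 2.2's inequality at `w = 2 + ε` for all TPP triples.  This
  generalises the tree's `exists_eps_noCertificate_family` (the case `k ≤ q^{2m+3}`,
  `|G| ≤ q^{(m+1)²}` tuned to type `A`) to the exponent shape of every family of groups of Lie type
  (`d = Θ(r²)`, `O(q^r)` classes); regimes: `r ≥ 8` by `noCertificate_of_few_classes`
  (`k^ε ≤ k^{1/(3(A+1))} ≤ q^{r/3} ≤ q^{2r/3}/2^{8/3} ≤ (n(G)/4)^{2/3}`), `r ≤ 7` and `|G| ≥ N₀` by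
  Cor. 3.3 (`n(G) ≥ ¼|G|^{1/(7(D+1))}`), `12 ≤ |G| < N₀` by Cor. 3.5, `|G| ≤ 11` by the finite check.
* §2 The elementary type-`C` inputs: `Sp.exists_not_commute` (`Sp(2n, F)` is non-abelian for
  `n ≥ 1`, witnesses `[[1,1],[0,1]]`, `[[1,0],[1,1]]` in `n × n` blocks), `PSp.exists_not_commute`
  (their images do not commute modulo the centre: the commutator `[[0,−1],[1,3]]` does not commute
  with `[[1,1],[0,1]]`), `Sp.card_le_pow` (`|Sp(2n, F)| ≤ q^{4n²}`), and the generic transfers to a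
  central quotient `secondCharDegree_le_quotient` (`n(G) ≤ n(G/N)`, inflation) and
  `card_conjClasses_quotient_le` (`k(G/N) ≤ k(G)`).
* §3 **`BCGPU2023_cor34_typeC_of_inputs`**: the named fact follows from the two printed inputs,
  stated INLINE as hypotheses (no new named fact, D-0026):
  (LS) `n(Sp(2n, 𝔽_q)) ≥ qⁿ/4` for all `n ≥ 1` and all finite fields — implied by the
  Landazuri–Seitz minimal degrees `n(PSp_{2n}(q)) ≥ ½(qⁿ − 1)` (`q` odd), the larger even-`q` bound,
  and `n(SL_2(q)) ≥ ½(q − 1)` [cite: LandazuriSeitz1974, §1 (table, p. 419)];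
  (FG) `k(Sp(2n, 𝔽_q)) ≤ q^{5n}` — implied by Fulman–Guralnick's `k(Sp(2n,q)) ≤ 10.8 qⁿ` (`q` odd,
  Thm. 3.12 (1)), `≤ 15.2 qⁿ` (`q` even, Thm. 3.13 (2)), and `15.2 qⁿ ≤ q^{n+4} ≤ q^{5n}`
  [cite: FulmanGuralnick2012, Thm. 3.12 (1) and Thm. 3.13 (2)].
  Neither input was in the tree when this file landed (the type-`A` analogues are:
  `SLnMinimalCharacterDegree.lean`, `GLnClassNumberBound.lean`); this file made the discharge of
  `BCGPU2023_cor34_typeC` EXACTLY the task of proving (LS) and (FG) for Mathlib's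
  `Matrix.symplecticGroup (Fin n) F`.  UPDATE (2026-08-27, later): (LS) is now PROVED in the weak
  form `n(Sp(2n,q)) ≥ q^{n−1} − 1` (`n ≥ 3`), `q ≤ 2 n(Sp(2n,q)) + 1` (all `n`)
  (`Literature/RepresentationTheory/FiniteGroups/SpMinimalCharacterDegree.lean`, via the Siegel Levi
  factor and `Literature/LinearAlgebra/Matrix/SymplecticGroupGeneration.lean`), and the sequel
  `QuasirandomBarrierLieTypeCOfClassNumber.lean` proves `BCGPU2023_cor34_typeC_of_classNumber`
  (the fact from (FG) ALONE, rank parameter `r = max(n−1,1)`) and, unconditionally, Cor. 3.4 for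
  symplectic groups of bounded rank (`BCGPU2023_noCertificate_Sp_rank_le`).

## Wording risks

* The hypotheses (LS), (FG) are convenient CONSEQUENCES of the cited theorems (constants `1/4`,
  exponent `5n`), chosen so that the single engine `exists_eps_noCertificate_family_gen 5 4` applies
  with `r = n`; they are weaker than print, never stronger, and they are hypotheses of a theorem, not
  vendored facts.
* `PSp(2n, F)` is, as in `QuasirandomBarrierLieTypeC.lean`, the quotient of `Sp(2n, F)` by its full
  centre.

WHAT THIS IS NOT: not a discharge of `BCGPU2023_cor34_typeC` (it stays a named fact until (LS) and
(FG) are proved); no statement about `ω`; nothing about the other Lie types.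
-/

noncomputable section

open scoped BigOperators
open Matrix

namespace Literature.Barriers.MatrixMultiplication

open Literature.RepresentationTheory.FiniteGroups Literature.Combinatorics.Additive

/-! ## §1 The uniform `ε` for an abstract Lie-type parameter set -/

section Family

/-- **BCGPU 2023, Cor. 3.4 (proof), as an engine for an arbitrary family**: for all `A, D : ℕ` there
is `ε > 0` such that every finite non-abelian group `G` with parameters `q ≥ 2`, `r ≥ 1` satisfying
`n(G) ≥ q^r/4` ("`n(G) ≥ Ω(q^r)`", Landazuri–Seitz), `k(G) ≤ q^{A r}` ("`O(q^r)` conjugacy classes",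
Fulman–Guralnick, any exponent linear in `r`) and `|G| ≤ q^{D r²}` ("`|G| = Θ(q^d)`", `d = O(r²)`)
satisfies `(|S||T||U|)^{(2+ε)/3} ≤ ∑ᵢ dᵢ^{2+ε}` for every TPP triple.  Large rank `r ≥ 8`:
`noCertificate_of_few_classes`; rank `≤ 7`: Cor. 3.3 with `c = 1/4`, `δ = 1/(7(D+1))`; small and tiny
groups: Cor. 3.5 and the finite check (tree).  Generalises `exists_eps_noCertificate_family`.
[cite: BlasiakCohnGrochowPrattUmans2023, Cor. 3.4 (proof)] -/
theorem exists_eps_noCertificate_family_gen (A D : ℕ) :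
    ∃ ε : ℝ, 0 < ε ∧ ∀ (q r : ℕ), 2 ≤ q → 1 ≤ r →
      ∀ (G : Type) [Group G] [Fintype G], (∃ a b : G, a * b ≠ b * a) →
        (q : ℝ) ^ r / 4 ≤ secondCharDegree G →
        (Nat.card (ConjClasses G) : ℝ) ≤ (q : ℝ) ^ (A * r) →
        (Fintype.card G : ℝ) ≤ (q : ℝ) ^ (D * r * r) →
        ∀ (S T U : Finset G), TripleProductProperty S T U →
          ((S.card * T.card * U.card : ℕ) : ℝ) ^ ((2 + ε) / 3) ≤ charDegreePowSum G (2 + ε) := by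
  classical
  obtain ⟨ε₂, hε₂, N₀, hN₀⟩ :=
    exists_eps_noCertificate_of_secondCharDegree_ge (c := 1 / 4) (δ := 1 / (7 * ((D : ℝ) + 1)))
      (by norm_num) (by positivity)
  obtain ⟨ε₃, hε₃, hsmall⟩ := exists_eps_noCertificate_of_card_le N₀
  set εL : ℝ := 1 / (3 * ((A : ℝ) + 1)) with hεL
  have hεL0 : 0 < εL := by positivity
  set ε : ℝ := min (min εL (1 / 200)) (min ε₂ ε₃) with hεdef
  have hε0 : 0 < ε := lt_min (lt_min hεL0 (by norm_num)) (lt_min hε₂ hε₃)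
  have hεL' : ε ≤ εL := (min_le_left _ _).trans (min_le_left _ _)
  have hε200 : ε ≤ 1 / 200 := (min_le_left _ _).trans (min_le_right _ _)
  have hεε₂ : ε ≤ ε₂ := (min_le_right _ _).trans (min_le_left _ _)
  have hεε₃ : ε ≤ ε₃ := (min_le_right _ _).trans (min_le_right _ _)
  refine ⟨ε, hε0, ?_⟩
  intro q r hq hr G _ _ hG hν hk hcard S T U hTPP
  have hq1 : (1 : ℝ) ≤ q := by exact_mod_cast (by omega : 1 ≤ q)
  have hq2 : (2 : ℝ) ≤ q := by exact_mod_cast hq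
  have hq0 : (0 : ℝ) < q := by linarith
  have hw2 : (2 : ℝ) ≤ 2 + ε := by linarith
  by_cases hr8 : 8 ≤ r
  · -- large rank: few conjugacy classes
    have h256 : (256 : ℝ) ≤ (q : ℝ) ^ r :=
      calc (256 : ℝ) = 2 ^ 8 := by norm_num
        _ ≤ (q : ℝ) ^ 8 := pow_le_pow_left₀ (by norm_num) hq2 8
        _ ≤ (q : ℝ) ^ r := pow_le_pow_right₀ hq1 hr8
    have hν4 : 4 ≤ secondCharDegree G := by
      have : (4 : ℝ) ≤ secondCharDegree G := by linarith
      exact_mod_cast this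
    refine noCertificate_of_few_classes G hG hν4 ?_ S T U hTPP hw2 le_rfl
    set k : ℝ := ((Nat.card (ConjClasses G) : ℕ) : ℝ) with hkdef
    set ν : ℝ := ((secondCharDegree G : ℕ) : ℝ) with hνdef
    have hk1 : (1 : ℝ) ≤ k := by
      rw [hkdef]
      have : 0 < Nat.card (ConjClasses G) := Nat.card_pos
      exact_mod_cast this
    have hk0 : 0 < k := by linarith
    -- `k^ε ≤ k^{εL} ≤ (q^{(A+1) r})^{εL} = q^{r/3}`
    have hAr : A * r ≤ (A + 1) * r := Nat.mul_le_mul_right r (Nat.le_succ A)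
    have hkA : k ≤ (q : ℝ) ^ ((A + 1) * r) := hk.trans (pow_le_pow_right₀ hq1 hAr)
    have h1 : k ^ ε ≤ k ^ εL := Real.rpow_le_rpow_of_exponent_le hk1 hεL'
    have h2 : k ^ εL ≤ ((q : ℝ) ^ ((A + 1) * r)) ^ εL := Real.rpow_le_rpow hk0.le hkA hεL0.le
    have hA0 : (3 * ((A : ℝ) + 1)) ≠ 0 := by positivity
    have h3 : ((q : ℝ) ^ ((A + 1) * r)) ^ εL = (q : ℝ) ^ ((r : ℝ) / 3) := by
      rw [← Real.rpow_natCast, ← Real.rpow_mul hq0.le]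
      congr 1
      rw [hεL]
      push_cast
      field_simp
    -- `(ν/4)^{2/3} ≥ (q^r/16)^{2/3} = q^{2r/3}/2^{8/3}` and `2^{8/3} ≤ q^{r/3}` (`2^8 ≤ q^r`)
    have h5 : ((q : ℝ) ^ r / 16) ^ (2 / 3 : ℝ) ≤ (ν / 4) ^ (2 / 3 : ℝ) :=
      Real.rpow_le_rpow (by positivity) (by linarith) (by norm_num)
    have h6 : ((q : ℝ) ^ r / 16) ^ (2 / 3 : ℝ) =
        (q : ℝ) ^ ((2 * (r : ℝ)) / 3) / (2 : ℝ) ^ (8 / 3 : ℝ) := by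
      rw [Real.div_rpow (by positivity) (by norm_num), ← Real.rpow_natCast, ← Real.rpow_mul hq0.le,
        show (16 : ℝ) = 2 ^ (4 : ℝ) by norm_num, ← Real.rpow_mul (by norm_num)]
      ring_nf
    have h4 : (2 : ℝ) ^ (8 / 3 : ℝ) ≤ (q : ℝ) ^ ((r : ℝ) / 3) := by
      have e2 : (2 : ℝ) ^ (8 / 3 : ℝ) = ((2 : ℝ) ^ (8 : ℕ)) ^ (1 / 3 : ℝ) := by
        rw [← Real.rpow_natCast, ← Real.rpow_mul (by norm_num)]
        norm_num
      have eq : (q : ℝ) ^ ((r : ℝ) / 3) = ((q : ℝ) ^ r) ^ (1 / 3 : ℝ) := by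
        rw [← Real.rpow_natCast, ← Real.rpow_mul hq0.le]
        ring_nf
      rw [e2, eq]
      exact Real.rpow_le_rpow (by positivity) (by norm_num at h256 ⊢; linarith [h256]) (by norm_num)
    have h28 : 0 < (2 : ℝ) ^ (8 / 3 : ℝ) := by positivity
    have h7 : (q : ℝ) ^ ((r : ℝ) / 3) ≤ (q : ℝ) ^ ((2 * (r : ℝ)) / 3) / (2 : ℝ) ^ (8 / 3 : ℝ) := by
      rw [le_div_iff₀ h28]
      have e : (q : ℝ) ^ ((2 * (r : ℝ)) / 3) = (q : ℝ) ^ ((r : ℝ) / 3) * (q : ℝ) ^ ((r : ℝ) / 3) := by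
        rw [← Real.rpow_add hq0]
        ring_nf
      rw [e]
      exact mul_le_mul_of_nonneg_left h4 (by positivity)
    calc k ^ ε ≤ k ^ εL := h1
      _ ≤ ((q : ℝ) ^ ((A + 1) * r)) ^ εL := h2
      _ = (q : ℝ) ^ ((r : ℝ) / 3) := h3
      _ ≤ (q : ℝ) ^ ((2 * (r : ℝ)) / 3) / (2 : ℝ) ^ (8 / 3 : ℝ) := h7
      _ = ((q : ℝ) ^ r / 16) ^ (2 / 3 : ℝ) := h6.symm
      _ ≤ (ν / 4) ^ (2 / 3 : ℝ) := h5
  · push Not at hr8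
    by_cases hbig : N₀ ≤ Fintype.card G
    · -- bounded rank, large group: Cor. 3.3 with `c = 1/4`, `δ = 1/(7(D+1))`
      have hmν : (1 / 4 : ℝ) * (Fintype.card G : ℝ) ^ (1 / (7 * ((D : ℝ) + 1))) ≤
          secondCharDegree G := by
        have hG0 : (0 : ℝ) ≤ Fintype.card G := Nat.cast_nonneg _
        have hexp : D * r * r ≤ 7 * (D + 1) * r := by
          have h7 : r ≤ 7 := by omega
          calc D * r * r ≤ D * 7 * r := by gcongr
            _ ≤ 7 * (D + 1) * r := by nlinarith
        have hcard' : (Fintype.card G : ℝ) ≤ (q : ℝ) ^ (7 * (D + 1) * r) :=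
          hcard.trans (pow_le_pow_right₀ hq1 hexp)
        have hD0 : (7 * ((D : ℝ) + 1)) ≠ 0 := by positivity
        have h1 : (Fintype.card G : ℝ) ^ (1 / (7 * ((D : ℝ) + 1))) ≤
            ((q : ℝ) ^ (7 * (D + 1) * r)) ^ (1 / (7 * ((D : ℝ) + 1))) :=
          Real.rpow_le_rpow hG0 hcard' (by positivity)
        have h2 : ((q : ℝ) ^ (7 * (D + 1) * r)) ^ (1 / (7 * ((D : ℝ) + 1))) = (q : ℝ) ^ r := by
          rw [← Real.rpow_natCast _ (7 * (D + 1) * r), ← Real.rpow_mul hq0.le,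
            ← Real.rpow_natCast _ r]
          congr 1
          push_cast
          field_simp
        rw [h2] at h1
        linarith [hν]
      exact hN₀ G hG hbig hmν S T U hTPP (2 + ε) hw2 (by linarith)
    · push Not at hbig
      by_cases h12 : 12 ≤ Fintype.card G
      · exact hsmall G h12 hbig.le S T U hTPP (2 + ε) hw2 (by linarith)
      · push Not at h12
        exact noCertificate_of_card_le_eleven G (by omega) S T U hTPP hw2 (by linarith)

end Family

/-! ## §2 Elementary inputs for `Sp(2n, F)` and central quotients -/

section Quotients

variable {G : Type} [Group G]

/-- `k(G/N) ≤ k(G)` (conjugacy classes map onto conjugacy classes).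
[cite: BlasiakCohnGrochowPrattUmans2023, Cor. 3.4 (remark after the proof: quotients by centres)] -/
theorem card_conjClasses_quotient_le [Finite G] (N : Subgroup G) [N.Normal] :
    Nat.card (ConjClasses (G ⧸ N)) ≤ Nat.card (ConjClasses G) :=
  Nat.card_le_card_of_surjective _ (ConjClasses.map_surjective (QuotientGroup.mk'_surjective N))

/-- **`n(G) ≤ n(G/N)` for a non-abelian quotient**: every irreducible character of `G/N` of degree
`> 1` inflates to an irreducible character of `G` of the same degree (tree
`IsIrrChar.comp_quotientMk`), so a lower bound for the degrees `> 1` of `G` bounds `n(G/N)`; used in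
print for `PSp = Sp/Z`. [cite: BlasiakCohnGrochowPrattUmans2023, Cor. 3.4 (remark after the proof: quotients by centres)] -/
theorem secondCharDegree_le_quotient [Finite G] (N : Subgroup G) [N.Normal]
    (hQ : ∃ a b : G ⧸ N, a * b ≠ b * a) : secondCharDegree G ≤ secondCharDegree (G ⧸ N) := by
  have hne' : {d : ℕ | d ∈ charDegrees (G ⧸ N) ∧ 1 < d}.Nonempty := by
    obtain ⟨d, hd, h1⟩ := Serre1977_thm9_holds.exists_one_lt_mem_charDegrees (G ⧸ N) hQ
    exact ⟨d, hd, h1⟩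
  have hmem : secondCharDegree (G ⧸ N) ∈ charDegrees (G ⧸ N) ∧ 1 < secondCharDegree (G ⧸ N) :=
    Nat.sInf_mem hne'
  obtain ⟨hd, h1⟩ := hmem
  -- `d = n(G/N)` is a character degree of `G` as well
  obtain ⟨χ, hχ, hχd⟩ := exists_isIrrChar_of_mem_charDegrees hd
  have hχ' : IsIrrChar G (χ ∘ QuotientGroup.mk) := IsIrrChar.comp_quotientMk N hχ
  obtain ⟨d', hd', hd'eq⟩ := hχ'.exists_apply_one
  have hdd' : secondCharDegree (G ⧸ N) = d' := by
    have : ((secondCharDegree (G ⧸ N) : ℕ) : ℂ) = d' := by rw [← hχd, ← hd'eq]; rfl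
    exact_mod_cast this
  have h1' : 1 < d' := hdd' ▸ h1
  exact (secondCharDegree_le hd' h1').2.trans hdd'.symm.le

end Quotients

section Symplectic

variable {F : Type} [Field F] {m : ℕ}

/-- The block-unipotent `[[1, 1], [0, 1]]` lies in `Sp(2(m+1), F)` (Mathlib's
`SymplecticGroup.fromBlocks_mem_iff`). [folklore] -/
private theorem upper_mem :
    Matrix.fromBlocks (1 : Matrix (Fin (m + 1)) (Fin (m + 1)) F) 1 0 1 ∈
      Matrix.symplecticGroup (Fin (m + 1)) F := by
  rw [SymplecticGroup.fromBlocks_mem_iff]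
  simp

/-- The block-unipotent `[[1, 0], [1, 1]]` lies in `Sp(2(m+1), F)`. [folklore] -/
private theorem lower_mem :
    Matrix.fromBlocks (1 : Matrix (Fin (m + 1)) (Fin (m + 1)) F) 0 1 1 ∈
      Matrix.symplecticGroup (Fin (m + 1)) F := by
  rw [SymplecticGroup.fromBlocks_mem_iff]
  simp

/-- `[[1, −1], [0, 1]] ∈ Sp` (the inverse of `[[1, 1], [0, 1]]`). [folklore] -/
private theorem upper_inv_mem :
    Matrix.fromBlocks (1 : Matrix (Fin (m + 1)) (Fin (m + 1)) F) (-1) 0 1 ∈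
      Matrix.symplecticGroup (Fin (m + 1)) F := by
  rw [SymplecticGroup.fromBlocks_mem_iff]
  simp

/-- `[[1, 0], [−1, 1]] ∈ Sp` (the inverse of `[[1, 0], [1, 1]]`). [folklore] -/
private theorem lower_inv_mem :
    Matrix.fromBlocks (1 : Matrix (Fin (m + 1)) (Fin (m + 1)) F) 0 (-1) 1 ∈
      Matrix.symplecticGroup (Fin (m + 1)) F := by
  rw [SymplecticGroup.fromBlocks_mem_iff]
  simp

/-- **`Sp(2n, F)` is non-abelian for `n ≥ 1`**: `[[1,1],[0,1]]` and `[[1,0],[1,1]]` (in `n × n`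
blocks) have products `[[2,1],[1,1]] ≠ [[1,1],[1,2]]` (the `(1,1)` entries differ by `1 ≠ 0`).
[cite: BlasiakCohnGrochowPrattUmans2023, Thm. 3.2 (hypothesis "finite nonabelian group") and footnote 2] -/
theorem Sp.exists_not_commute (m : ℕ) :
    ∃ a b : Matrix.symplecticGroup (Fin (m + 1)) F, a * b ≠ b * a := by
  refine ⟨⟨_, upper_mem⟩, ⟨_, lower_mem⟩, fun h => ?_⟩
  have h' := congrArg (fun x : Matrix.symplecticGroup (Fin (m + 1)) F =>
    x.1 (Sum.inl (0 : Fin (m + 1))) (Sum.inl (0 : Fin (m + 1)))) h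
  simp [Matrix.fromBlocks_multiply] at h'

/-- **`PSp(2n, F) = Sp(2n, F)/Z` is non-abelian for `n ≥ 1`**: if the images of
`a = [[1,1],[0,1]]` and `b = [[1,0],[1,1]]` commuted, the commutator `b⁻¹a⁻¹ba = [[0,−1],[1,3]]`
would be central, but it does not commute with `a` (the `(1,1)` blocks of the two products are `1`
and `0`). [cite: BlasiakCohnGrochowPrattUmans2023, Cor. 3.4 (remark after the proof: quotients by centres)] -/
theorem PSp.exists_not_commute (m : ℕ) :
    ∃ a b : Matrix.symplecticGroup (Fin (m + 1)) F ⧸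
      Subgroup.center (Matrix.symplecticGroup (Fin (m + 1)) F), a * b ≠ b * a := by
  set a : Matrix.symplecticGroup (Fin (m + 1)) F := ⟨_, upper_mem⟩ with ha
  set b : Matrix.symplecticGroup (Fin (m + 1)) F := ⟨_, lower_mem⟩ with hb
  set a' : Matrix.symplecticGroup (Fin (m + 1)) F := ⟨_, upper_inv_mem⟩ with ha'
  set b' : Matrix.symplecticGroup (Fin (m + 1)) F := ⟨_, lower_inv_mem⟩ with hb'
  have haa' : a⁻¹ = a' := by
    refine inv_eq_of_mul_eq_one_right (Subtype.ext ?_)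
    change (Matrix.fromBlocks (1 : Matrix (Fin (m + 1)) (Fin (m + 1)) F) 1 0 1) *
      Matrix.fromBlocks 1 (-1) 0 1 = 1
    rw [Matrix.fromBlocks_multiply, ← Matrix.fromBlocks_one]
    simp
  have hbb' : b⁻¹ = b' := by
    refine inv_eq_of_mul_eq_one_right (Subtype.ext ?_)
    change (Matrix.fromBlocks (1 : Matrix (Fin (m + 1)) (Fin (m + 1)) F) 0 1 1) *
      Matrix.fromBlocks 1 0 (-1) 1 = 1
    rw [Matrix.fromBlocks_multiply, ← Matrix.fromBlocks_one]
    simp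
  refine ⟨QuotientGroup.mk a, QuotientGroup.mk b, fun h => ?_⟩
  have hmem : (a * b)⁻¹ * (b * a) ∈ Subgroup.center (Matrix.symplecticGroup (Fin (m + 1)) F) := by
    rw [← QuotientGroup.eq]
    simpa only [QuotientGroup.mk_mul] using h
  rw [_root_.mul_inv_rev, haa', hbb'] at hmem
  have hc := Subgroup.mem_center_iff.1 hmem a
  have h' := congrArg (fun x : Matrix.symplecticGroup (Fin (m + 1)) F =>
    x.1 (Sum.inl (0 : Fin (m + 1))) (Sum.inl (0 : Fin (m + 1)))) hc
  simp [ha, hb, ha', hb', Matrix.fromBlocks_multiply] at h'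

/-- `|Sp(2n, F)| ≤ q^{4n²}` (a subset of the `2n × 2n` matrices; print: `|G| = Θ(q^d)`,
`d = 2n² + n`). [cite: BlasiakCohnGrochowPrattUmans2023, Cor. 3.4 (proof: "`|G| = Θ(q^d)`")] -/
theorem Sp.card_le_pow [Fintype F] (n : ℕ) [Fintype (Matrix.symplecticGroup (Fin n) F)] :
    Fintype.card (Matrix.symplecticGroup (Fin n) F) ≤ Fintype.card F ^ (4 * n * n) := by
  classical
  calc Fintype.card (Matrix.symplecticGroup (Fin n) F)
      ≤ Fintype.card (Matrix (Fin n ⊕ Fin n) (Fin n ⊕ Fin n) F) :=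
        Fintype.card_le_of_injective (fun A => (A : Matrix _ _ F)) Subtype.val_injective
    _ = Fintype.card F ^ (4 * n * n) := by
        change Fintype.card (Fin n ⊕ Fin n → Fin n ⊕ Fin n → F) = _
        rw [Fintype.card_fun, Fintype.card_fun, Fintype.card_sum, Fintype.card_fin, ← pow_mul]
        congr 1
        ring

end Symplectic

/-! ## §3 `BCGPU2023_cor34_typeC` from the two printed inputs -/

section Assembly

/-- **BCGPU 2023, Cor. 3.4 for `Sp(2n, q)` and `PSp(2n, q)`, reduced to its printed inputs**: the
named fact `BCGPU2023_cor34_typeC` follows from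
(LS) `qⁿ/4 ≤ n(Sp(2n, 𝔽_q))` for all `n ≥ 1`, all finite fields (a consequence of the
Landazuri–Seitz minimal degrees, [cite: LandazuriSeitz1974, §1 (table, p. 419)]), and
(FG) `k(Sp(2n, 𝔽_q)) ≤ q^{5n}` (a consequence of `k(Sp(2n,q)) ≤ 15.2 qⁿ`,
[cite: FulmanGuralnick2012, Thm. 3.12 (1) and Thm. 3.13 (2)]) — both HYPOTHESES here, not
vendored — via `exists_eps_noCertificate_family_gen 5 4` (`|Sp(2n,q)| ≤ q^{4n²}`), the `PSp` case by
`k(PSp) ≤ k(Sp)`, `n(PSp) ≥ n(Sp)`, `|PSp| ≤ |Sp|`.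
[cite: BlasiakCohnGrochowPrattUmans2023, Cor. 3.4] -/
theorem BCGPU2023_cor34_typeC_of_inputs
    (hLS : ∀ (F : Type) [Field F] [Fintype F] (n : ℕ), 1 ≤ n →
      (Fintype.card F : ℝ) ^ n / 4 ≤ secondCharDegree (Matrix.symplecticGroup (Fin n) F))
    (hFG : ∀ (F : Type) [Field F] [Fintype F] (n : ℕ), 1 ≤ n →
      Nat.card (ConjClasses (Matrix.symplecticGroup (Fin n) F)) ≤ Fintype.card F ^ (5 * n)) :
    BCGPU2023_cor34_typeC := by
  classical
  obtain ⟨ε, hε, hfam⟩ := exists_eps_noCertificate_family_gen 5 4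
  refine ⟨ε, hε, ?_⟩
  intro F _ _ n hn
  obtain ⟨m, rfl⟩ : ∃ m, n = m + 1 := ⟨n - 1, by omega⟩
  letI : Fintype (Matrix.symplecticGroup (Fin (m + 1)) F) := Fintype.ofFinite _
  letI : Fintype (Matrix.symplecticGroup (Fin (m + 1)) F ⧸
      Subgroup.center (Matrix.symplecticGroup (Fin (m + 1)) F)) := Fintype.ofFinite _
  set q : ℕ := Fintype.card F with hq
  have hq2 : 2 ≤ q := Fintype.one_lt_card
  have hq1 : (1 : ℝ) ≤ q := by exact_mod_cast (by omega : 1 ≤ q)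
  -- the inputs for `Sp`
  have hG := Sp.exists_not_commute (F := F) m
  have hν := hLS F (m + 1) hn
  have hkNat : Nat.card (ConjClasses (Matrix.symplecticGroup (Fin (m + 1)) F)) ≤ q ^ (5 * (m + 1)) :=
    hFG F (m + 1) hn
  have hk : (Nat.card (ConjClasses (Matrix.symplecticGroup (Fin (m + 1)) F)) : ℝ) ≤
      (q : ℝ) ^ (5 * (m + 1)) := by exact_mod_cast hkNat
  have hcardNat := Sp.card_le_pow (F := F) (m + 1)
  have hcard : (Fintype.card (Matrix.symplecticGroup (Fin (m + 1)) F) : ℝ) ≤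
      (q : ℝ) ^ (4 * (m + 1) * (m + 1)) := by exact_mod_cast hcardNat
  constructor
  · intro S T U hTPP
    exact hfam q (m + 1) hq2 hn _ hG hν hk hcard S T U hTPP
  · intro S T U hTPP
    have hQ := PSp.exists_not_commute (F := F) m
    have hνQ : (q : ℝ) ^ (m + 1) / 4 ≤ secondCharDegree (Matrix.symplecticGroup (Fin (m + 1)) F ⧸
        Subgroup.center (Matrix.symplecticGroup (Fin (m + 1)) F)) :=
      hν.trans (by exact_mod_cast secondCharDegree_le_quotient _ hQ)
    have hkQ : (Nat.card (ConjClasses (Matrix.symplecticGroup (Fin (m + 1)) F ⧸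
        Subgroup.center (Matrix.symplecticGroup (Fin (m + 1)) F))) : ℝ) ≤ (q : ℝ) ^ (5 * (m + 1)) := by
      exact_mod_cast (card_conjClasses_quotient_le _).trans hkNat
    have hcardQ : (Fintype.card (Matrix.symplecticGroup (Fin (m + 1)) F ⧸
        Subgroup.center (Matrix.symplecticGroup (Fin (m + 1)) F)) : ℝ) ≤
        (q : ℝ) ^ (4 * (m + 1) * (m + 1)) := by
      exact_mod_cast (Fintype.card_le_of_surjective _ (QuotientGroup.mk_surjective)).trans hcardNat
    exact hfam q (m + 1) hq2 hn _ hQ hνQ hkQ hcardQ S T U hTPP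

end Assembly

end Literature.Barriers.MatrixMultiplication

end
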